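import Literature.NumberTheory.Rogawski1990.ArchOrbFamGExtTwoChartDescent      -- ★ p851074 (LH3-p04 (g4)): (α) two-chart descent `exists_descent_twoChart_chartOrbG`; brings ★ (c-wall), ★ `orbFamGExt`, ★ chart atlas
import Literature.NumberTheory.Rogawski1990.ArchOrbFamGExtWallFactorWick       -- ★ p851055 (LH1-p03 (g5)): `wallFactorR_eq_two_cos_sub`, `archERhoG_mul_splitCofactor_eq_splitWallFactorR`, `splitWallFactorR_eq_two_cosh_sub`
import Literature.NumberTheory.Rogawski1990.ArchOrbFamGExtCayleyBoxValue        -- ★ (F0P3a-p05 (g20)) (β): `orbFamGExt_eqOn_cofactor_mul_of_splitDescent`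
import Literature.NumberTheory.Automorphic.ArchRankOneSplitOrbitContinuity      -- ★ (A0-b) `abs_sub_smul_integral_descConj_hypBlockGL_eq_smul_integral_prod`
import HarnessLib

/-!
# (B-jc) THE (0,2)-JUNCTION, part 1 — the two DRESSES: the twisted genuine family `e^{ρ}·orbFamGExt` on the compact chart and on the Cayley chart, read through ONE block
# family in the currency of ★ `hasOneSidedJump_iteratedFDeriv_adaptedWord_of_twoChart` (Harish-Chandra descent; Rogawski 1990 §8.2; Shelstad 1979 Lemma 4.3; Bouaziz 1994 §3.2 (I₃))

Topic `NumberTheory/Rogawski1990`; namespace `Literature.NumberTheory.Rogawski1990`.  THEOREMS ONLY (no `def`, no instance, no notation, no axiom, no named fact, no `sorry`);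
kernel lane `--kind proof --supports stmt-HodgeConjecture-24833`.  Cell `pub/hodgecm-mathlib`, crux H413 (`stmt-HodgeConjecture-24833`), F0∕P3c line LH3 (leaf
`F0_P3c_StubN9Direct` v5, organ O-L1b′ `stub_N9hcJumpWall02 : HcJumpWall02Statement`), SPEC-I3 brick **(B-jc)** (F0P3a-p08 (g23), spec-owner).
Given the (α) TWO-CHART DESCENT identities (★ p851074, taken as BINDERS `hdescS`∕`hdesc♯` so this file is independent of the `∃`-unpacking) for ONE block family
`f : (coords) × M₂(ℂ) → ℂ` and ONE constant `K`:
* §1 `smul_coe_conj_cayleyTorus` — the centre `z ∈ S¹` is a scalar: `z • ↑↑(h · P diag(u) P⁻¹ · h⁻¹) = ↑↑(h · P diag(z u) P⁻¹ · h⁻¹)`;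
* §2 **`archERhoG_mul_orbFamGExt_eq_compactReader`** — on the compact chart `S`, off the wall `(w₀,0,2)`:
  `e^{ρ}_S(c) · orbFamGExt ν′ a′ S c = (K·i) · ((2cos ν − 2cos δ₀)·Π(π c) − E(π c)) · Φ₁ (g (π c)) (ν)` with `ν = (c_{w₀0} − c_{w₀2})∕2`, `π c = c − ν • hcNrm`, the FIXED centre-`1`
  Cayley reader `Φ₁ F ψ = (2 sin ψ) · ∫_{U(J)} F(↑↑(h P diag(e^{i0}e^{iψ}, e^{i0}e^{−iψ}) P⁻¹ h⁻¹)) dμ₀` ((B-r1) ★ p851059's `hF` token at `θ = 0`), the centre-absorbed family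
  `g q X = f (q, e^{i(q_{w₀0}+q_{w₀2})∕2} • X)` (★ p851073), `Π` the frozen root product and `E q = (2cos(q_{w₀0} − q_{w₀1}) − 2cos δ₀)·Π q` (★ (c-wall) + ★ `wallFactorR_eq_two_cos_sub`);
* §3 **`archERhoG_mul_orbFamGExt_eq_splitReader`** — on the Cayley chart `S ∪ {w₀}` THROUGH the real wall:
  `e^{ρ}_{S∪w₀}(c″) · orbFamGExt ν′ a′ (S ∪ {w₀}) c″ = (K·C′) · ((2cosh x − 2cos δ₀)·Π(B c″) − E(B c″)) · Φ₂ (g (B c″)) (x)`, `x = c″_{w₀0}`, `B c″ = update c″ w₀ (θ, φ, θ)`, the FIXED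
  split reader `Φ₂ F x = ∫_{K×N} F(↑↑(k · t_{0,0} h_{x∕2} n h_{x∕2} · k⁻¹)) d(κ ⊗ μ_N)` ((B-r1)'s `hΛ` token at `θ = 0`), `C′` the Iwasawa constant of `μ₀′` (★ (A0-b) + ★ (β)).
These are EXACTLY the `hdesc₁`∕`hdesc₂` binders of ★ p851048 with `K₁ = K·i`, `K₂ = K·C′`, `ce = 2cos − 2cos δ₀`, `ch = 2cosh − 2cos δ₀` — so the descent constant `K` CANCELS in
`jc′ = (K₁∕K₂)·κ₀`.  Part 2 (`ArchOrbFamGExtJumpWall02`) supplies the readers' (H1)(H2), (B-r1) and (B-wick), and concludes `HcJumpWall02Statement`.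
HONEST LABEL: count-neutral; HC_CM is proved only modulo the 7 printed citations (2 remaining: hLiu418 = stmt-HodgeConjecture-24832, h413 = stmt-HodgeConjecture-24833) until rung 0 closes.

## References
* [Rogawski1990] J. D. Rogawski, *Automorphic Representations of Unitary Groups in Three Variables*, Ann. of Math. Stud. 123 (1990), §8.2 pp. 118–124.
* [Shelstad1979] D. Shelstad, *Characters and inner forms of a quasi-split group over ℝ*, Compositio Math. 39 (1979), Lemma 4.3 p. 25, Prop. 4.5 p. 26.
* [Bouaziz1994IntegralesOrbitales] A. Bouaziz, *Intégrales orbitales sur les groupes de Lie réductifs*, Ann. Sci. ÉNS 27 (1994), §3.2 (I₃) p. 580.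
* [Varadarajan1977] V. S. Varadarajan, *Harmonic Analysis on Real Reductive Groups*, LNM 576 (1977), Part I §1.12.
-/

set_option autoImplicit false

noncomputable section

open MeasureTheory MeasureTheory.Measure NumberField NumberField.InfinitePlace Matrix Complex Set Filter Topology
open scoped MatrixGroups Matrix Real Classical ENNReal NNReal ContDiff Matrix.Norms.Operator
open Literature.NumberTheory.Automorphic Literature.NumberTheory.Automorphic.UnitaryGroup Literature.NumberTheory.Automorphic.ArchCartan
open Literature.MeasureTheory.Group

namespace Literature.NumberTheory.Rogawski1990

/-! ## §1 The centre is a scalar on the Cayley torus -/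

section Centre

variable {J : Matrix (Fin 2) (Fin 2) ℂ} (hJ : J = (StdForm.antidiagonal 2).over ℂ)

include hJ in
/-- **`z • ↑↑(h · P diag(u) P⁻¹ · h⁻¹) = ↑↑(h · P diag(z·u) P⁻¹ · h⁻¹)`** — the centre of `U(J)` acts on the Cayley torus point by a scalar (★ `orbitalIntegral_centre_eq`'s
computation on the Cayley carrier). [cite: Rogawski1990, §8.2 p. 119] -/
theorem smul_coe_conj_cayleyTorus (h : ↥(unitaryGroupOfForm (starRingEnd ℂ) J)) (z : Circle) (u : Fin 2 → Circle) :
    (z : ℂ) • ((((h * ⟨Matrix.GeneralLinearGroup.mkOfDetNeZero !![(1 : ℂ), 1; 1, -1] det_cayleyTwo_ne_zero * circleDiagonal 2 u *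
            (Matrix.GeneralLinearGroup.mkOfDetNeZero !![(1 : ℂ), 1; 1, -1] det_cayleyTwo_ne_zero)⁻¹, cayley_conj_circleDiagonal_mem_of_eq_over hJ u⟩ * h⁻¹ :
          ↥(unitaryGroupOfForm (starRingEnd ℂ) J)) : GL (Fin 2) ℂ) : Matrix (Fin 2) (Fin 2) ℂ)) =
      ((((h * ⟨Matrix.GeneralLinearGroup.mkOfDetNeZero !![(1 : ℂ), 1; 1, -1] det_cayleyTwo_ne_zero * circleDiagonal 2 (fun i => z * u i) *
            (Matrix.GeneralLinearGroup.mkOfDetNeZero !![(1 : ℂ), 1; 1, -1] det_cayleyTwo_ne_zero)⁻¹, cayley_conj_circleDiagonal_mem_of_eq_over hJ _⟩ * h⁻¹ :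
          ↥(unitaryGroupOfForm (starRingEnd ℂ) J)) : GL (Fin 2) ℂ) : Matrix (Fin 2) (Fin 2) ℂ)) := by
  have hdiag : Matrix.diagonal (fun i => ((z * u i : Circle) : ℂ)) = (z : ℂ) • Matrix.diagonal (fun i => (u i : ℂ)) := by
    ext i j
    by_cases hij : i = j
    · subst hij; simp [Circle.coe_mul]
    · simp [Matrix.diagonal_apply_ne _ hij]
  simp only [Subgroup.coe_mul, Subgroup.coe_inv, Units.val_mul, coe_circleDiagonal, hdiag, Matrix.mul_smul, Matrix.smul_mul]

end Centre

/-! ## §2 The compact-chart dress -/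


section WallProj

variable {W : Type*} [DecidableEq W]

/-- The wall decomposition `c = π c + ν • hcNrm w₀ 0 2` with `ν = (c_{w₀0} − c_{w₀2})∕2`, `π c` ON the wall. [cite: Shelstad1979, Lemma 4.3 (p. 25)] -/
theorem eq_wallProj_add_smul_hcNrm (w₀ : W) (c : W → Fin 3 → ℝ) :
    c = (c - ((c w₀ 0 - c w₀ 2) / 2) • hcNrm w₀ 0 2) + ((c w₀ 0 - c w₀ 2) / 2) • hcNrm w₀ 0 2 := by
  abel

/-- `π c` lies on the wall: its slots `0` and `2` at `w₀` agree (both equal the mean). [cite: Shelstad1979, Lemma 4.3 (p. 25)] -/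
theorem wallProj_apply_zero_eq_two (w₀ : W) (c : W → Fin 3 → ℝ) :
    (c - ((c w₀ 0 - c w₀ 2) / 2) • hcNrm w₀ 0 2) w₀ 0 = (c - ((c w₀ 0 - c w₀ 2) / 2) • hcNrm w₀ 0 2) w₀ 2 := by
  simp [hcNrm]; ring

/-- The slots of `π c` at `w₀`: `(mean, c_{w₀1}, mean)`; the other places are untouched. [cite: Shelstad1979, Lemma 4.3 (p. 25)] -/
theorem wallProj_apply (w₀ : W) (c : W → Fin 3 → ℝ) :
    (c - ((c w₀ 0 - c w₀ 2) / 2) • hcNrm w₀ 0 2) w₀ 0 = (c w₀ 0 + c w₀ 2) / 2 ∧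
    (c - ((c w₀ 0 - c w₀ 2) / 2) • hcNrm w₀ 0 2) w₀ 1 = c w₀ 1 ∧
    (c - ((c w₀ 0 - c w₀ 2) / 2) • hcNrm w₀ 0 2) w₀ 2 = (c w₀ 0 + c w₀ 2) / 2 ∧
    ∀ w, w ≠ w₀ → (c - ((c w₀ 0 - c w₀ 2) / 2) • hcNrm w₀ 0 2) w = c w := by
  refine ⟨?_, ?_, ?_, fun w hw => ?_⟩
  · simp [hcNrm]; ring
  · simp [hcNrm]
  · simp [hcNrm]; ring
  · funext l; simp [hcNrm, hw]

end WallProj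

section Compact2

variable (L : Type) [Field L] [NumberField L] [IsCMField L] (α : Fin 3 → L)
  [MeasurableSpace ↥(arch (↥(maximalRealSubfield L)) L (IsCMField.complexConj L) 3 (Matrix.diagonal α))]
  [BorelSpace ↥(arch (↥(maximalRealSubfield L)) L (IsCMField.complexConj L) 3 (Matrix.diagonal α))]
  (ν' : Measure ↥(arch (↥(maximalRealSubfield L)) L (IsCMField.complexConj L) 3 (Matrix.diagonal α))) [IsFiniteMeasureOnCompacts ν'] [ν'.IsMulRightInvariant]
  (a' : ↥(arch (↥(maximalRealSubfield L)) L (IsCMField.complexConj L) 3 (Matrix.diagonal α)) → ℂ)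
  {J : Matrix (Fin 2) (Fin 2) ℂ} (hJ : J = (StdForm.antidiagonal 2).over ℂ)
  [MeasurableSpace ↥(unitaryGroupOfForm (starRingEnd ℂ) J)] (μ₀ : Measure ↥(unitaryGroupOfForm (starRingEnd ℂ) J))

include hJ in
/-- **THE COMPACT-CHART DRESS.**  Under the (α) compact-chart descent identity `hdescS` (★ p851074's first clause, as a binder) and the tangential clause `hftan`, for every
`c ∈ U` that is `G`-regular for `S` (admissible, `w₀ ∉ S`):
`e^{ρ}_S(c) · orbFamGExt ν′ a′ S c = (K·i) · ((2cos ν − 2cos δ₀)·Π(π c) − E(π c)) · Φ₁ (g (π c)) (ν)` with the centre-`1` Cayley reader `Φ₁`, the centre-absorbed family `g` and the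
frozen products written out — the `hdesc₁` binder of ★ `hasOneSidedJump_iteratedFDeriv_adaptedWord_of_twoChart` with `K₁ = K·i`.
[cite: Rogawski1990, §8.2 pp. 118–122] [cite: Shelstad1979, Lemma 4.3 (p. 25)] [cite: Varadarajan1977, I §1.12] -/
theorem archERhoG_mul_orbFamGExt_eq_compactReader {S : Finset {w : InfinitePlace L // IsComplex w}} {w₀ : {w : InfinitePlace L // IsComplex w}}
    (hS : ∀ w, w ∈ S → w ∈ splitChartPlaces L α) (hw₀ : w₀ ∉ S)
    {K : ℂ} {U : Set ({w : InfinitePlace L // IsComplex w} → Fin 3 → ℝ)} {f : ({w : InfinitePlace L // IsComplex w} → Fin 3 → ℝ) × Matrix (Fin 2) (Fin 2) ℂ → ℂ}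
    (hftan : ∀ c X, f (c, X) = f (Function.update c w₀ ![0, c w₀ 1, 0], X))
    (hdescS : ∀ c ∈ U ∩ RegG S, chartOrbG L α ν' S a' c =
      K * ∫ h : ↥(unitaryGroupOfForm (starRingEnd ℂ) J),
        f (c, (((h * ⟨Matrix.GeneralLinearGroup.mkOfDetNeZero !![(1 : ℂ), 1; 1, -1] det_cayleyTwo_ne_zero *
              circleDiagonal 2 ![Circle.exp (c w₀ 0), Circle.exp (c w₀ 2)] *
              (Matrix.GeneralLinearGroup.mkOfDetNeZero !![(1 : ℂ), 1; 1, -1] det_cayleyTwo_ne_zero)⁻¹,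
            cayley_conj_circleDiagonal_mem_of_eq_over hJ _⟩ * h⁻¹ : ↥(unitaryGroupOfForm (starRingEnd ℂ) J)) : GL (Fin 2) ℂ) : Matrix (Fin 2) (Fin 2) ℂ)) ∂μ₀)
    (δ₀ : ℝ) {c : {w : InfinitePlace L // IsComplex w} → Fin 3 → ℝ} (hcU : c ∈ U) (hcreg : c ∈ RegG S) :
    archERhoG S c * orbFamGExt L α ν' a' S c =
      (K * I) *
        ((((2 * Real.cos ((c w₀ 0 - c w₀ 2) / 2) - 2 * Real.cos δ₀ : ℝ)) : ℂ) * (∏ w' ∈ Finset.univ.erase w₀,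
            ((if w' ∈ S then (1 : ℂ) else (Circle.exp ((c - ((c w₀ 0 - c w₀ 2) / 2) • hcNrm w₀ 0 2) w' 0 - (c - ((c w₀ 0 - c w₀ 2) / 2) • hcNrm w₀ 0 2) w' 2) : ℂ)) *
              (if w' ∈ S then
                  ((|Real.exp ((c - ((c w₀ 0 - c w₀ 2) / 2) • hcNrm w₀ 0 2) w' 0) - Real.exp (-(c - ((c w₀ 0 - c w₀ 2) / 2) • hcNrm w₀ 0 2) w' 0)| *
                    ‖cexp ((c - ((c w₀ 0 - c w₀ 2) / 2) • hcNrm w₀ 0 2) w' 0 + (c - ((c w₀ 0 - c w₀ 2) / 2) • hcNrm w₀ 0 2) w' 2 * I) - cexp ((c - ((c w₀ 0 - c w₀ 2) / 2) • hcNrm w₀ 0 2) w' 1 * I)‖ * ‖cexp (-(c - ((c w₀ 0 - c w₀ 2) / 2) • hcNrm w₀ 0 2) w' 0 + (c - ((c w₀ 0 - c w₀ 2) / 2) • hcNrm w₀ 0 2) w' 2 * I) - cexp ((c - ((c w₀ 0 - c w₀ 2) / 2) • hcNrm w₀ 0 2) w' 1 * I)‖ : ℝ) : ℂ)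
                else (1 - (Circle.exp ((c - ((c w₀ 0 - c w₀ 2) / 2) • hcNrm w₀ 0 2) w' 1 - (c - ((c w₀ 0 - c w₀ 2) / 2) • hcNrm w₀ 0 2) w' 0) : ℂ)) * (1 - (Circle.exp ((c - ((c w₀ 0 - c w₀ 2) / 2) • hcNrm w₀ 0 2) w' 2 - (c - ((c w₀ 0 - c w₀ 2) / 2) • hcNrm w₀ 0 2) w' 0) : ℂ)) * (1 - (Circle.exp ((c - ((c w₀ 0 - c w₀ 2) / 2) • hcNrm w₀ 0 2) w' 2 - (c - ((c w₀ 0 - c w₀ 2) / 2) • hcNrm w₀ 0 2) w' 1) : ℂ))))) -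
          (((2 * Real.cos ((c - ((c w₀ 0 - c w₀ 2) / 2) • hcNrm w₀ 0 2) w₀ 0 - (c - ((c w₀ 0 - c w₀ 2) / 2) • hcNrm w₀ 0 2) w₀ 1) - 2 * Real.cos δ₀ : ℝ)) : ℂ) * (∏ w' ∈ Finset.univ.erase w₀,
            ((if w' ∈ S then (1 : ℂ) else (Circle.exp ((c - ((c w₀ 0 - c w₀ 2) / 2) • hcNrm w₀ 0 2) w' 0 - (c - ((c w₀ 0 - c w₀ 2) / 2) • hcNrm w₀ 0 2) w' 2) : ℂ)) *
              (if w' ∈ S then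
                  ((|Real.exp ((c - ((c w₀ 0 - c w₀ 2) / 2) • hcNrm w₀ 0 2) w' 0) - Real.exp (-(c - ((c w₀ 0 - c w₀ 2) / 2) • hcNrm w₀ 0 2) w' 0)| *
                    ‖cexp ((c - ((c w₀ 0 - c w₀ 2) / 2) • hcNrm w₀ 0 2) w' 0 + (c - ((c w₀ 0 - c w₀ 2) / 2) • hcNrm w₀ 0 2) w' 2 * I) - cexp ((c - ((c w₀ 0 - c w₀ 2) / 2) • hcNrm w₀ 0 2) w' 1 * I)‖ * ‖cexp (-(c - ((c w₀ 0 - c w₀ 2) / 2) • hcNrm w₀ 0 2) w' 0 + (c - ((c w₀ 0 - c w₀ 2) / 2) • hcNrm w₀ 0 2) w' 2 * I) - cexp ((c - ((c w₀ 0 - c w₀ 2) / 2) • hcNrm w₀ 0 2) w' 1 * I)‖ : ℝ) : ℂ)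
                else (1 - (Circle.exp ((c - ((c w₀ 0 - c w₀ 2) / 2) • hcNrm w₀ 0 2) w' 1 - (c - ((c w₀ 0 - c w₀ 2) / 2) • hcNrm w₀ 0 2) w' 0) : ℂ)) * (1 - (Circle.exp ((c - ((c w₀ 0 - c w₀ 2) / 2) • hcNrm w₀ 0 2) w' 2 - (c - ((c w₀ 0 - c w₀ 2) / 2) • hcNrm w₀ 0 2) w' 0) : ℂ)) * (1 - (Circle.exp ((c - ((c w₀ 0 - c w₀ 2) / 2) • hcNrm w₀ 0 2) w' 2 - (c - ((c w₀ 0 - c w₀ 2) / 2) • hcNrm w₀ 0 2) w' 1) : ℂ)))))) *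
        ((2 * Real.sin ((c w₀ 0 - c w₀ 2) / 2) : ℂ) *
          ∫ h : ↥(unitaryGroupOfForm (starRingEnd ℂ) J),
            f (c - ((c w₀ 0 - c w₀ 2) / 2) • hcNrm w₀ 0 2,
              ((Circle.exp (((c - ((c w₀ 0 - c w₀ 2) / 2) • hcNrm w₀ 0 2) w₀ 0 + (c - ((c w₀ 0 - c w₀ 2) / 2) • hcNrm w₀ 0 2) w₀ 2) / 2) : Circle) : ℂ) •
                (((h * ⟨Matrix.GeneralLinearGroup.mkOfDetNeZero !![(1 : ℂ), 1; 1, -1] det_cayleyTwo_ne_zero *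
                    circleDiagonal 2 ![Circle.exp 0 * Circle.exp ((c w₀ 0 - c w₀ 2) / 2), Circle.exp 0 * Circle.exp (-((c w₀ 0 - c w₀ 2) / 2))] *
                    (Matrix.GeneralLinearGroup.mkOfDetNeZero !![(1 : ℂ), 1; 1, -1] det_cayleyTwo_ne_zero)⁻¹,
                  cayley_conj_circleDiagonal_mem_of_eq_over hJ _⟩ * h⁻¹ : ↥(unitaryGroupOfForm (starRingEnd ℂ) J)) : GL (Fin 2) ℂ) : Matrix (Fin 2) (Fin 2) ℂ)) ∂μ₀) := by
  -- the wall projection `q := c − ν • hcNrm` (kept expanded) and its slots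
  obtain ⟨hq0, hq1, hq2, hqw⟩ := wallProj_apply w₀ c
  have hq02 := wallProj_apply_zero_eq_two w₀ c
  have hcq := eq_wallProj_add_smul_hcNrm w₀ c
  -- the raw member on `RegG S` and the (α) identity
  rw [orbFamGExt_of_mem_regG_of_admissible L α ν' a' S hS hcreg, ← mul_assoc, hdescS c ⟨hcU, hcreg⟩]
  -- the wall factor at the base point `q`
  have hwall := archERhoG_mul_archRG_add_smul_hcNrm_eq S hw₀ hq02 ((c w₀ 0 - c w₀ 2) / 2)
  rw [← hcq] at hwall
  rw [hwall, congrFun (wallFactorR_eq_two_cos_sub S w₀ (c - ((c w₀ 0 - c w₀ 2) / 2) • hcNrm w₀ 0 2)) ((c w₀ 0 - c w₀ 2) / 2)]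
  -- the integrands agree: centre absorption + tangential clause
  have hθν0 : ((c - ((c w₀ 0 - c w₀ 2) / 2) • hcNrm w₀ 0 2) w₀ 0 + (c - ((c w₀ 0 - c w₀ 2) / 2) • hcNrm w₀ 0 2) w₀ 2) / 2 + (0 + ((c w₀ 0 - c w₀ 2) / 2)) = c w₀ 0 := by rw [hq0, hq2]; ring
  have hθν2 : ((c - ((c w₀ 0 - c w₀ 2) / 2) • hcNrm w₀ 0 2) w₀ 0 + (c - ((c w₀ 0 - c w₀ 2) / 2) • hcNrm w₀ 0 2) w₀ 2) / 2 + (0 + -((c w₀ 0 - c w₀ 2) / 2)) = c w₀ 2 := by rw [hq0, hq2]; ring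
  have hvec : (fun i : Fin 2 => Circle.exp (((c - ((c w₀ 0 - c w₀ 2) / 2) • hcNrm w₀ 0 2) w₀ 0 + (c - ((c w₀ 0 - c w₀ 2) / 2) • hcNrm w₀ 0 2) w₀ 2) / 2) * (![Circle.exp 0 * Circle.exp ((c w₀ 0 - c w₀ 2) / 2), Circle.exp 0 * Circle.exp (-((c w₀ 0 - c w₀ 2) / 2))] i)) =
      ![Circle.exp (c w₀ 0), Circle.exp (c w₀ 2)] := by
    funext i
    fin_cases i
    · simp only [Fin.zero_eta, Fin.isValue, Matrix.cons_val_zero, ← Circle.exp_add, hθν0]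
    · simp only [Fin.mk_one, Fin.isValue, Matrix.cons_val_one, Matrix.cons_val_fin_one, ← Circle.exp_add, hθν2]
  have hupd : Function.update (c - ((c w₀ 0 - c w₀ 2) / 2) • hcNrm w₀ 0 2) w₀ ![0, (c - ((c w₀ 0 - c w₀ 2) / 2) • hcNrm w₀ 0 2) w₀ 1, 0] = Function.update c w₀ ![0, c w₀ 1, 0] := by
    rw [hq1]
    funext w
    by_cases hw : w = w₀
    · subst hw; simp
    · rw [Function.update_of_ne hw, Function.update_of_ne hw, hqw w hw]
  have hint : (∫ h : ↥(unitaryGroupOfForm (starRingEnd ℂ) J),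
      f (c - ((c w₀ 0 - c w₀ 2) / 2) • hcNrm w₀ 0 2, ((Circle.exp (((c - ((c w₀ 0 - c w₀ 2) / 2) • hcNrm w₀ 0 2) w₀ 0 + (c - ((c w₀ 0 - c w₀ 2) / 2) • hcNrm w₀ 0 2) w₀ 2) / 2) : Circle) : ℂ) •
        (((h * ⟨Matrix.GeneralLinearGroup.mkOfDetNeZero !![(1 : ℂ), 1; 1, -1] det_cayleyTwo_ne_zero *
              circleDiagonal 2 ![Circle.exp 0 * Circle.exp ((c w₀ 0 - c w₀ 2) / 2), Circle.exp 0 * Circle.exp (-((c w₀ 0 - c w₀ 2) / 2))] *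
              (Matrix.GeneralLinearGroup.mkOfDetNeZero !![(1 : ℂ), 1; 1, -1] det_cayleyTwo_ne_zero)⁻¹,
            cayley_conj_circleDiagonal_mem_of_eq_over hJ _⟩ * h⁻¹ : ↥(unitaryGroupOfForm (starRingEnd ℂ) J)) : GL (Fin 2) ℂ) : Matrix (Fin 2) (Fin 2) ℂ)) ∂μ₀) =
      ∫ h : ↥(unitaryGroupOfForm (starRingEnd ℂ) J),
        f (c, (((h * ⟨Matrix.GeneralLinearGroup.mkOfDetNeZero !![(1 : ℂ), 1; 1, -1] det_cayleyTwo_ne_zero *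
              circleDiagonal 2 ![Circle.exp (c w₀ 0), Circle.exp (c w₀ 2)] *
              (Matrix.GeneralLinearGroup.mkOfDetNeZero !![(1 : ℂ), 1; 1, -1] det_cayleyTwo_ne_zero)⁻¹,
            cayley_conj_circleDiagonal_mem_of_eq_over hJ _⟩ * h⁻¹ : ↥(unitaryGroupOfForm (starRingEnd ℂ) J)) : GL (Fin 2) ℂ) : Matrix (Fin 2) (Fin 2) ℂ)) ∂μ₀ := by
    refine integral_congr_ae (Eventually.of_forall fun h => ?_)
    simp only []
    rw [smul_coe_conj_cayleyTorus hJ h, hftan (c - ((c w₀ 0 - c w₀ 2) / 2) • hcNrm w₀ 0 2), hupd, ← hftan c]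
    have hT : (⟨Matrix.GeneralLinearGroup.mkOfDetNeZero !![(1 : ℂ), 1; 1, -1] det_cayleyTwo_ne_zero *
          circleDiagonal 2 (fun i : Fin 2 => Circle.exp (((c - ((c w₀ 0 - c w₀ 2) / 2) • hcNrm w₀ 0 2) w₀ 0 + (c - ((c w₀ 0 - c w₀ 2) / 2) • hcNrm w₀ 0 2) w₀ 2) / 2) * (![Circle.exp 0 * Circle.exp ((c w₀ 0 - c w₀ 2) / 2), Circle.exp 0 * Circle.exp (-((c w₀ 0 - c w₀ 2) / 2))] i)) *
          (Matrix.GeneralLinearGroup.mkOfDetNeZero !![(1 : ℂ), 1; 1, -1] det_cayleyTwo_ne_zero)⁻¹, cayley_conj_circleDiagonal_mem_of_eq_over hJ _⟩ : ↥(unitaryGroupOfForm (starRingEnd ℂ) J)) =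
        ⟨Matrix.GeneralLinearGroup.mkOfDetNeZero !![(1 : ℂ), 1; 1, -1] det_cayleyTwo_ne_zero * circleDiagonal 2 ![Circle.exp (c w₀ 0), Circle.exp (c w₀ 2)] *
          (Matrix.GeneralLinearGroup.mkOfDetNeZero !![(1 : ℂ), 1; 1, -1] det_cayleyTwo_ne_zero)⁻¹, cayley_conj_circleDiagonal_mem_of_eq_over hJ _⟩ := Subtype.ext (by rw [hvec])
    rw [hT]
  rw [hint]
  simp only [Complex.ofReal_sub, Complex.ofReal_mul, Complex.ofReal_ofNat]
  ring

end Compact2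

/-! ## §3 The Cayley-chart dress (through the real wall) -/

section SplitToken

variable {J : Matrix (Fin 2) (Fin 2) ℂ} (hJ : J = (StdForm.antidiagonal 2).over ℂ)
  [MeasurableSpace ↥(unitaryGroupOfForm (starRingEnd ℂ) J)] [BorelSpace ↥(unitaryGroupOfForm (starRingEnd ℂ) J)]
  {K₁ : Subgroup ↥(unitaryGroupOfForm (starRingEnd ℂ) J)} (κ : Measure ↥K₁) (μN : Measure ↥(unipotentU (starRingEnd ℂ) J))
  [MeasurableSpace (↥(unitaryGroupOfForm (starRingEnd ℂ) J) ⧸ torusU (starRingEnd ℂ) J)] [BorelSpace (↥(unitaryGroupOfForm (starRingEnd ℂ) J) ⧸ torusU (starRingEnd ℂ) J)]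
  (μ₀' : Measure (↥(unitaryGroupOfForm (starRingEnd ℂ) J) ⧸ torusU (starRingEnd ℂ) J))

include hJ in
/-- **THE SPLIT TOKEN IS `C′ •` THE `K × N` CHART — AT EVERY `x`, THROUGH `x = 0`.**  If `μ₀′ = C′ • ((k,n) ↦ knT)_*(κ ⊗ μ_N)` (★ `exists_measure_quotient_torusU_complex_two_eq_smul_map`)
and a CONTINUOUS `G` carries the normalised split token of the continuous, uniformly compactly supported family `f` off `x = 0` (★ p851099's `hGtoken`), then
`G (q, x, θ) = C′ • ∫_{K×N} f_q(↑↑(k · t_{0,θ} h_{x∕2} n h_{x∕2} · k⁻¹)) d(κ ⊗ μ_N)` for ALL `x`: off `0` this is ★ (A0-b); both sides are continuous in `x` (★ `continuous_integral_prod_conj_hypBlockGL_half`)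
and `{0}ᶜ` is dense. [cite: Varadarajan1989, §6.4 Lemma 21, Thm 23] [cite: Rogawski1990, §8.2 p. 119] [cite: Shelstad1979, Lemma 4.3 (p. 25)] -/
theorem eq_smul_integral_prod_of_splitToken [IsHaarMeasure κ] [IsHaarMeasure μN] (hK₁ : IsCompact (K₁ : Set ↥(unitaryGroupOfForm (starRingEnd ℂ) J))) {C' : ℝ≥0}
    (hμC : μ₀' = C' • Measure.map
      (fun p : ↥K₁ × ↥(unipotentU (starRingEnd ℂ) J) => (QuotientGroup.mk (((p.1 : ↥K₁) : ↥(unitaryGroupOfForm (starRingEnd ℂ) J)) * ((p.2 : ↥(unipotentU (starRingEnd ℂ) J)) : ↥(unitaryGroupOfForm (starRingEnd ℂ) J))) : ↥(unitaryGroupOfForm (starRingEnd ℂ) J) ⧸ torusU (starRingEnd ℂ) J))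
      (κ.prod μN))
    {Q : Type*} [TopologicalSpace Q] (f : Q × Matrix (Fin 2) (Fin 2) ℂ → ℂ) (hf : Continuous f)
    {C : Set (Matrix (Fin 2) (Fin 2) ℂ)} (hC : IsCompact C) (hfC : ∀ q X, X ∉ C → f (q, X) = 0)
    (G : Q × ℝ × ℝ → ℂ) (hG : Continuous G)
    (hGtoken : ∀ (q : Q) (x θ : ℝ), x ≠ 0 →
      |Real.exp x - Real.exp (-x)| •
        ∫ y, descConj (⟨hypBlockGL x θ, hypBlockGL_mem_of_eq_over hJ x θ⟩ : ↥(unitaryGroupOfForm (starRingEnd ℂ) J)) (torusU (starRingEnd ℂ) J)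
          (LineRing.forall_mem_torusU_comm (starRingEnd ℂ) J (hypBlockGL_mem_torusU hJ x θ))
          (fun h : ↥(unitaryGroupOfForm (starRingEnd ℂ) J) => f (q, ((h : GL (Fin 2) ℂ) : Matrix (Fin 2) (Fin 2) ℂ))) y ∂μ₀' = G (q, x, θ))
    (q : Q) (x θ : ℝ) :
    G (q, x, θ) = (C' : ℝ) • ∫ p : ↥K₁ × ↥(unipotentU (starRingEnd ℂ) J), f (q, ((((((p.1 : ↥K₁) : ↥(unitaryGroupOfForm (starRingEnd ℂ) J)) * ((⟨hypBlockGL 0 θ, hypBlockGL_mem_of_eq_over hJ 0 θ⟩ : ↥(unitaryGroupOfForm (starRingEnd ℂ) J)) * (⟨hypBlockGL (x / 2) 0, hypBlockGL_mem_of_eq_over hJ (x / 2) 0⟩ : ↥(unitaryGroupOfForm (starRingEnd ℂ) J)) * ((p.2 : ↥(unipotentU (starRingEnd ℂ) J)) : ↥(unitaryGroupOfForm (starRingEnd ℂ) J)) * (⟨hypBlockGL (x / 2) 0, hypBlockGL_mem_of_eq_over hJ (x / 2) 0⟩ : ↥(unitaryGroupOfForm (starRingEnd ℂ) J))) * ((p.1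 : ↥K₁) : ↥(unitaryGroupOfForm (starRingEnd ℂ) J))⁻¹ : ↥(unitaryGroupOfForm (starRingEnd ℂ) J))) : GL (Fin 2) ℂ) : Matrix (Fin 2) (Fin 2) ℂ)) ∂(κ.prod μN) := by
  haveI : CompactSpace ↥K₁ := isCompact_iff_compactSpace.1 hK₁
  have hFc : Continuous fun h : ↥(unitaryGroupOfForm (starRingEnd ℂ) J) => f (q, ((h : GL (Fin 2) ℂ) : Matrix (Fin 2) (Fin 2) ℂ)) :=
    hf.comp (continuous_const.prodMk (Units.continuous_val.comp continuous_subtype_val))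
  have hFs : HasCompactSupport fun h : ↥(unitaryGroupOfForm (starRingEnd ℂ) J) => f (q, ((h : GL (Fin 2) ℂ) : Matrix (Fin 2) (Fin 2) ℂ)) :=
    HasCompactSupport.intro ((isClosedEmbedding_coe_unitaryGroupOfForm_of_eq_over hJ).isCompact_preimage hC) (fun h hh => hfC q _ hh)
  have h1 : Continuous fun x : ℝ => G (q, x, θ) := hG.comp (continuous_const.prodMk (continuous_id.prodMk continuous_const))
  have h2 : Continuous fun x : ℝ => (C' : ℝ) • ∫ p : ↥K₁ × ↥(unipotentU (starRingEnd ℂ) J), f (q, ((((((p.1 : ↥K₁) : ↥(unitaryGroupOfForm (starRingEnd ℂ) J)) * ((⟨hypBlockGL 0 θ, hypBlockGL_mem_of_eq_over hJ 0 θ⟩ : ↥(unitaryGroupOfForm (starRingEnd ℂ) J)) * (⟨hypBlockGL (x / 2) 0, hypBlockGL_mem_of_eq_over hJ (x / 2) 0⟩ : ↥(unitaryGroupOfForm (starRingEnd ℂ) J)) * ((p.2 : ↥(unipotentU (starRingEnd ℂ) J)) : ↥(unitaryGroupOfForm (starRingEnd ℂ) J)) * (⟨hypBlockGL (x / 2)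 0, hypBlockGL_mem_of_eq_over hJ (x / 2) 0⟩ : ↥(unitaryGroupOfForm (starRingEnd ℂ) J))) * ((p.1 : ↥K₁) : ↥(unitaryGroupOfForm (starRingEnd ℂ) J))⁻¹ : ↥(unitaryGroupOfForm (starRingEnd ℂ) J))) : GL (Fin 2) ℂ) : Matrix (Fin 2) (Fin 2) ℂ)) ∂(κ.prod μN) :=
    (continuous_integral_prod_conj_hypBlockGL_half hJ κ μN hK₁ (fun h : ↥(unitaryGroupOfForm (starRingEnd ℂ) J) => f (q, ((h : GL (Fin 2) ℂ) : Matrix (Fin 2) (Fin 2) ℂ))) hFc hFs θ) |> (continuous_const (y := (C' : ℝ))).smul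
  have heq : EqOn (fun x : ℝ => G (q, x, θ)) (fun x : ℝ => (C' : ℝ) • ∫ p : ↥K₁ × ↥(unipotentU (starRingEnd ℂ) J), f (q, ((((((p.1 : ↥K₁) : ↥(unitaryGroupOfForm (starRingEnd ℂ) J)) * ((⟨hypBlockGL 0 θ, hypBlockGL_mem_of_eq_over hJ 0 θ⟩ : ↥(unitaryGroupOfForm (starRingEnd ℂ) J)) * (⟨hypBlockGL (x / 2) 0, hypBlockGL_mem_of_eq_over hJ (x / 2) 0⟩ : ↥(unitaryGroupOfForm (starRingEnd ℂ) J)) * ((p.2 : ↥(unipotentU (starRingEnd ℂ) J)) : ↥(unitaryGroupOfForm (starRingEnd ℂ) J)) * (⟨hypBlockGL (x / 2) 0, hypBlockGL_mem_of_eq_over hJ (x / 2) 0⟩ : ↥(unitaryGroupOfForm (starRingEnd ℂ) J))) * ((p.1 : ↥K₁) : ↥(unitaryGroupOfForm (starRingEnd ℂ) J))⁻¹ : ↥(unitaryGroupOfForm (starRingEnd ℂ) J))) : GL (Fin 2) ℂ) : Matrix (Fin 2) (Fin 2) ℂ)) ∂(κ.prod μN)) ({(0 : ℝ)}ᶜ)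 := by
    intro x hx
    have hx' : x ≠ 0 := hx
    simp only []
    rw [← hGtoken q x θ hx']
    exact abs_sub_smul_integral_descConj_hypBlockGL_eq_smul_integral_prod hJ κ μN μ₀' hμC _ hFc θ hx'
  exact congrFun (Continuous.ext_on (dense_compl_singleton 0) h1 h2 heq) x

end SplitToken

section SplitCentre

variable {J : Matrix (Fin 2) (Fin 2) ℂ} (hJ : J = (StdForm.antidiagonal 2).over ℂ)

include hJ in
/-- **Centre absorption on the split token**: `e^{iθ} • ↑↑(k · t_{0,0} h n h · k⁻¹) = ↑↑(k · t_{0,θ} h n h · k⁻¹)` (`t_{0,θ} = e^{iθ}·1` is central: ★ `coe_hypBlockGL_zero_left`).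
[cite: Rogawski1990, §8.2 p. 119; §3.6 p. 31] -/
theorem smul_coe_conj_splitToken (k n : ↥(unitaryGroupOfForm (starRingEnd ℂ) J)) (x θ : ℝ) :
    ((Circle.exp θ : Circle) : ℂ) • ((((k * ((⟨hypBlockGL 0 0, hypBlockGL_mem_of_eq_over hJ 0 0⟩ : ↥(unitaryGroupOfForm (starRingEnd ℂ) J)) * (⟨hypBlockGL (x / 2) 0, hypBlockGL_mem_of_eq_over hJ (x / 2) 0⟩ : ↥(unitaryGroupOfForm (starRingEnd ℂ) J)) * n * (⟨hypBlockGL (x / 2) 0, hypBlockGL_mem_of_eq_over hJ (x / 2) 0⟩ : ↥(unitaryGroupOfForm (starRingEnd ℂ) J))) * k⁻¹ : ↥(unitaryGroupOfForm (starRingEnd ℂ) J))) : GL (Fin 2) ℂ) : Matrix (Fin 2) (Fin 2) ℂ) =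
      ((((k * ((⟨hypBlockGL 0 θ, hypBlockGL_mem_of_eq_over hJ 0 θ⟩ : ↥(unitaryGroupOfForm (starRingEnd ℂ) J)) * (⟨hypBlockGL (x / 2) 0, hypBlockGL_mem_of_eq_over hJ (x / 2) 0⟩ : ↥(unitaryGroupOfForm (starRingEnd ℂ) J)) * n * (⟨hypBlockGL (x / 2) 0, hypBlockGL_mem_of_eq_over hJ (x / 2) 0⟩ : ↥(unitaryGroupOfForm (starRingEnd ℂ) J))) * k⁻¹ : ↥(unitaryGroupOfForm (starRingEnd ℂ) J))) : GL (Fin 2) ℂ) : Matrix (Fin 2) (Fin 2) ℂ) := by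
  simp only [Subgroup.coe_mul, Subgroup.coe_inv, Units.val_mul, coe_hypBlockGL_zero_left, Circle.coe_exp, Complex.ofReal_zero, zero_mul, Complex.exp_zero,
    one_smul, Matrix.one_mul, Matrix.smul_mul, Matrix.mul_smul]

end SplitCentre

section Split2

variable (L : Type) [Field L] [NumberField L] [IsCMField L] (α : Fin 3 → L)
  [MeasurableSpace ↥(arch (↥(maximalRealSubfield L)) L (IsCMField.complexConj L) 3 (Matrix.diagonal α))]
  [BorelSpace ↥(arch (↥(maximalRealSubfield L)) L (IsCMField.complexConj L) 3 (Matrix.diagonal α))]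
  (ν' : Measure ↥(arch (↥(maximalRealSubfield L)) L (IsCMField.complexConj L) 3 (Matrix.diagonal α))) [IsFiniteMeasureOnCompacts ν'] [ν'.IsMulRightInvariant]
  (a' : ↥(arch (↥(maximalRealSubfield L)) L (IsCMField.complexConj L) 3 (Matrix.diagonal α)) → ℂ)
  {J : Matrix (Fin 2) (Fin 2) ℂ} (hJ : J = (StdForm.antidiagonal 2).over ℂ)
  [MeasurableSpace ↥(unitaryGroupOfForm (starRingEnd ℂ) J)] {K₁ : Subgroup ↥(unitaryGroupOfForm (starRingEnd ℂ) J)} (κ : Measure ↥K₁) (μN : Measure ↥(unipotentU (starRingEnd ℂ) J))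

include hJ in
/-- **THE CAYLEY-CHART DRESS.**  Under the (β) through-the-wall identity `hEq` (★ p851099's `EqOn` clause at the point `c″`), the split token in `K × N` currency `hGΛ`
(`eq_smul_integral_prod_of_splitToken`) and the tangential clause `hftan`:
`e^{ρ}_{S∪w₀}(c″) · orbFamGExt ν′ a′ (S ∪ {w₀}) c″ = (K·C′) · ((2cosh x − 2cos δ₀)·Π(B c″) − E(B c″)) · Φ₂ (g (B c″)) (x)`, `x = c″_{w₀0}`, `B c″ = update c″ w₀ (θ, φ, θ)`, with the
centre-`1` split reader and the centre-absorbed family written out — the `hdesc₂` binder of ★ `hasOneSidedJump_iteratedFDeriv_adaptedWord_of_twoChart` with `K₂ = K·C′`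
(★ `archERhoG_mul_splitCofactor_eq_splitWallFactorR`, ★ `splitWallFactorR_eq_two_cosh_sub`). [cite: Rogawski1990, §8.2 pp. 118–119] [cite: Shelstad1979, Lemma 4.3 (p. 25)]
[cite: Varadarajan1989, §6.4 Thm 23] [cite: Bouaziz1994IntegralesOrbitales, §3.2 (I₃) p. 580] -/
theorem archERhoG_mul_orbFamGExt_eq_splitReader (S : Finset {w : InfinitePlace L // IsComplex w}) (w₀ : {w : InfinitePlace L // IsComplex w})
    {K : ℂ} {C' : ℝ≥0} {f : ({w : InfinitePlace L // IsComplex w} → Fin 3 → ℝ) × Matrix (Fin 2) (Fin 2) ℂ → ℂ}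
    (hftan : ∀ c X, f (c, X) = f (Function.update c w₀ ![0, c w₀ 1, 0], X))
    {G : (({w : InfinitePlace L // IsComplex w} → Fin 3 → ℝ) × ℝ × ℝ) → ℂ}
    (hGΛ : ∀ (q : {w : InfinitePlace L // IsComplex w} → Fin 3 → ℝ) (x θ : ℝ),
      G (q, x, θ) = (C' : ℝ) • ∫ p : ↥K₁ × ↥(unipotentU (starRingEnd ℂ) J), f (q, ((((((p.1 : ↥K₁) : ↥(unitaryGroupOfForm (starRingEnd ℂ) J)) * ((⟨hypBlockGL 0 θ, hypBlockGL_mem_of_eq_over hJ 0 θ⟩ : ↥(unitaryGroupOfForm (starRingEnd ℂ) J)) * (⟨hypBlockGL (x / 2) 0, hypBlockGL_mem_of_eq_over hJ (x / 2) 0⟩ : ↥(unitaryGroupOfForm (starRingEnd ℂ) J)) * ((p.2 : ↥(unipotentU (starRingEnd ℂ) J)) : ↥(unitaryGroupOfForm (starRingEnd ℂ) J)) * (⟨hypBlockGL (x / 2) 0, hypBlockGL_mem_of_eq_over hJ (x / 2) 0⟩ : ↥(unitaryGroupOfForm (starRingEnd ℂ) J))) * ((p.1 : ↥K₁) : ↥(unitaryGroupOfForm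 (starRingEnd ℂ) J))⁻¹ : ↥(unitaryGroupOfForm (starRingEnd ℂ) J))) : GL (Fin 2) ℂ) : Matrix (Fin 2) (Fin 2) ℂ)) ∂(κ.prod μN))
    (δ₀ : ℝ) {c : {w : InfinitePlace L // IsComplex w} → Fin 3 → ℝ}
    (hEq : orbFamGExt L α ν' a' (insert w₀ S) c =
      ((((‖Complex.exp (c w₀ 0 + c w₀ 2 * Complex.I) - Complex.exp (c w₀ 1 * Complex.I)‖ * ‖Complex.exp (-c w₀ 0 + c w₀ 2 * Complex.I) - Complex.exp (c w₀ 1 * Complex.I)‖ : ℝ) : ℂ) *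
            ∏ w' ∈ Finset.univ.erase w₀,
              (if w' ∈ insert w₀ S then
                  ((|Real.exp (c w' 0) - Real.exp (-c w' 0)| *
                    ‖Complex.exp (c w' 0 + c w' 2 * Complex.I) - Complex.exp (c w' 1 * Complex.I)‖ * ‖Complex.exp (-c w' 0 + c w' 2 * Complex.I) - Complex.exp (c w' 1 * Complex.I)‖ : ℝ) : ℂ)
                else (1 - (Circle.exp (c w' 1 - c w' 0) : ℂ)) * (1 - (Circle.exp (c w' 2 - c w' 0) : ℂ)) * (1 - (Circle.exp (c w' 2 - c w' 1) : ℂ))))) *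
          (K * G (Function.update c w₀ ![0, c w₀ 1, 0], c w₀ 0, c w₀ 2))) :
    archERhoG (insert w₀ S) c * orbFamGExt L α ν' a' (insert w₀ S) c =
      (K * ((C' : ℝ) : ℂ)) *
        ((((2 * Real.cosh (c w₀ 0) - 2 * Real.cos δ₀ : ℝ)) : ℂ) * (∏ w' ∈ Finset.univ.erase w₀,
            ((if w' ∈ S then (1 : ℂ) else (Circle.exp ((Function.update c w₀ (fun s => if s = hcThird 0 2 then c w₀ 1 else c w₀ 2)) w' 0 - (Function.update c w₀ (fun s => if s = hcThird 0 2 then c w₀ 1 else c w₀ 2)) w' 2) : ℂ)) *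
              (if w' ∈ S then
                  ((|Real.exp ((Function.update c w₀ (fun s => if s = hcThird 0 2 then c w₀ 1 else c w₀ 2)) w' 0) - Real.exp (-(Function.update c w₀ (fun s => if s = hcThird 0 2 then c w₀ 1 else c w₀ 2)) w' 0)| *
                    ‖cexp ((Function.update c w₀ (fun s => if s = hcThird 0 2 then c w₀ 1 else c w₀ 2)) w' 0 + (Function.update c w₀ (fun s => if s = hcThird 0 2 then c w₀ 1 else c w₀ 2)) w' 2 * I) - cexp ((Function.update c w₀ (fun s => if s = hcThird 0 2 then c w₀ 1 else c w₀ 2)) w' 1 * I)‖ * ‖cexp (-(Function.update c w₀ (fun s => if s = hcThird 0 2 then c w₀ 1 else c w₀ 2)) w' 0 + (Function.update c w₀ (fun s => if s = hcThird 0 2 then c w₀ 1 else c w₀ 2)) w' 2 * I) - cexp ((Function.update c w₀ (fun s => if s = hcThird 0 2 then c w₀ 1 else c w₀ 2)) w' 1 * I)‖ : ℝ) : ℂ)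
                else (1 - (Circle.exp ((Function.update c w₀ (fun s => if s = hcThird 0 2 then c w₀ 1 else c w₀ 2)) w' 1 - (Function.update c w₀ (fun s => if s = hcThird 0 2 then c w₀ 1 else c w₀ 2)) w' 0) : ℂ)) * (1 - (Circle.exp ((Function.update c w₀ (fun s => if s = hcThird 0 2 then c w₀ 1 else c w₀ 2)) w' 2 - (Function.update c w₀ (fun s => if s = hcThird 0 2 then c w₀ 1 else c w₀ 2)) w' 0) : ℂ)) * (1 - (Circle.exp ((Function.update c w₀ (fun s => if s = hcThird 0 2 then c w₀ 1 else c w₀ 2)) w' 2 - (Function.update c w₀ (fun s => if s = hcThird 0 2 then c w₀ 1 else c w₀ 2)) w' 1) : ℂ))))) -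
          (((2 * Real.cos ((Function.update c w₀ (fun s => if s = hcThird 0 2 then c w₀ 1 else c w₀ 2)) w₀ 0 - (Function.update c w₀ (fun s => if s = hcThird 0 2 then c w₀ 1 else c w₀ 2)) w₀ 1) - 2 * Real.cos δ₀ : ℝ)) : ℂ) * (∏ w' ∈ Finset.univ.erase w₀,
            ((if w' ∈ S then (1 : ℂ) else (Circle.exp ((Function.update c w₀ (fun s => if s = hcThird 0 2 then c w₀ 1 else c w₀ 2)) w' 0 - (Function.update c w₀ (fun s => if s = hcThird 0 2 then c w₀ 1 else c w₀ 2)) w' 2) : ℂ)) *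
              (if w' ∈ S then
                  ((|Real.exp ((Function.update c w₀ (fun s => if s = hcThird 0 2 then c w₀ 1 else c w₀ 2)) w' 0) - Real.exp (-(Function.update c w₀ (fun s => if s = hcThird 0 2 then c w₀ 1 else c w₀ 2)) w' 0)| *
                    ‖cexp ((Function.update c w₀ (fun s => if s = hcThird 0 2 then c w₀ 1 else c w₀ 2)) w' 0 + (Function.update c w₀ (fun s => if s = hcThird 0 2 then c w₀ 1 else c w₀ 2)) w' 2 * I) - cexp ((Function.update c w₀ (fun s => if s = hcThird 0 2 then c w₀ 1 else c w₀ 2)) w' 1 * I)‖ * ‖cexp (-(Function.update c w₀ (fun s => if s = hcThird 0 2 then c w₀ 1 else c w₀ 2)) w' 0 + (Function.update c w₀ (fun s => if s = hcThird 0 2 then c w₀ 1 else c w₀ 2)) w' 2 * I) - cexp ((Function.update c w₀ (fun s => if s = hcThird 0 2 then c w₀ 1 else c w₀ 2)) w' 1 * I)‖ : ℝ) : ℂ)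
                else (1 - (Circle.exp ((Function.update c w₀ (fun s => if s = hcThird 0 2 then c w₀ 1 else c w₀ 2)) w' 1 - (Function.update c w₀ (fun s => if s = hcThird 0 2 then c w₀ 1 else c w₀ 2)) w' 0) : ℂ)) * (1 - (Circle.exp ((Function.update c w₀ (fun s => if s = hcThird 0 2 then c w₀ 1 else c w₀ 2)) w' 2 - (Function.update c w₀ (fun s => if s = hcThird 0 2 then c w₀ 1 else c w₀ 2)) w' 0) : ℂ)) * (1 - (Circle.exp ((Function.update c w₀ (fun s => if s = hcThird 0 2 then c w₀ 1 else c w₀ 2)) w' 2 - (Function.update c w₀ (fun s => if s = hcThird 0 2 then c w₀ 1 else c w₀ 2)) w' 1) : ℂ)))))) *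
        ∫ p : ↥K₁ × ↥(unipotentU (starRingEnd ℂ) J), f ((Function.update c w₀ (fun s => if s = hcThird 0 2 then c w₀ 1 else c w₀ 2)), ((Circle.exp (((Function.update c w₀ (fun s => if s = hcThird 0 2 then c w₀ 1 else c w₀ 2)) w₀ 0 + (Function.update c w₀ (fun s => if s = hcThird 0 2 then c w₀ 1 else c w₀ 2)) w₀ 2) / 2) : Circle) : ℂ) • ((((((p.1 : ↥K₁) : ↥(unitaryGroupOfForm (starRingEnd ℂ) J)) * ((⟨hypBlockGL 0 0, hypBlockGL_mem_of_eq_over hJ 0 0⟩ : ↥(unitaryGroupOfForm (starRingEnd ℂ) J)) * (⟨hypBlockGL (c w₀ 0 / 2) 0, hypBlockGL_mem_of_eq_over hJ (c w₀ 0 / 2) 0⟩ : ↥(unitaryGroupOfForm (starRingEnd ℂ) J)) * ((p.2 : ↥(unipotentU (starRingEnd ℂ) J)) : ↥(unitaryGroupOfForm (starRingEnd ℂ) J)) * (⟨hypBlockGL (c w₀ 0 / 2) 0, hypBlockGL_mem_of_eq_over hJ (c w₀ 0 / 2) 0⟩ : ↥(unitaryGroupOfForm (starRingEnd ℂ) J)))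 * ((p.1 : ↥K₁) : ↥(unitaryGroupOfForm (starRingEnd ℂ) J))⁻¹ : ↥(unitaryGroupOfForm (starRingEnd ℂ) J))) : GL (Fin 2) ℂ) : Matrix (Fin 2) (Fin 2) ℂ)) ∂(κ.prod μN) := by
  -- the slots of `B c`
  have hB0 : (Function.update c w₀ (fun s => if s = hcThird 0 2 then c w₀ 1 else c w₀ 2)) w₀ 0 = c w₀ 2 := by simp
  have hB1 : (Function.update c w₀ (fun s => if s = hcThird 0 2 then c w₀ 1 else c w₀ 2)) w₀ 1 = c w₀ 1 := by simp
  have hB2 : (Function.update c w₀ (fun s => if s = hcThird 0 2 then c w₀ 1 else c w₀ 2)) w₀ 2 = c w₀ 2 := by simp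
  have hBw : ∀ w', w' ≠ w₀ → (Function.update c w₀ (fun s => if s = hcThird 0 2 then c w₀ 1 else c w₀ 2)) w' = c w' := fun w' hw' => Function.update_of_ne hw' _ _
  have hBupd : Function.update (Function.update c w₀ (fun s => if s = hcThird 0 2 then c w₀ 1 else c w₀ 2)) w₀ ![0, (Function.update c w₀ (fun s => if s = hcThird 0 2 then c w₀ 1 else c w₀ 2)) w₀ 1, 0] = Function.update c w₀ ![0, c w₀ 1, 0] := by
    rw [hB1, Function.update_idem]
  have hθ : ((Function.update c w₀ (fun s => if s = hcThird 0 2 then c w₀ 1 else c w₀ 2)) w₀ 0 + (Function.update c w₀ (fun s => if s = hcThird 0 2 then c w₀ 1 else c w₀ 2)) w₀ 2) / 2 = c w₀ 2 := by rw [hB0, hB2]; ring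
  -- the raw identity and the split wall factor at the base point `B c`
  rw [hEq, ← mul_assoc, archERhoG_mul_splitCofactor_eq_splitWallFactorR S (p := (Function.update c w₀ (fun s => if s = hcThird 0 2 then c w₀ 1 else c w₀ 2))) (x := c w₀ 0) rfl hB1.symm hB0.symm (fun w' hw' => (hBw w' hw').symm),
    congrFun (splitWallFactorR_eq_two_cosh_sub S w₀ (Function.update c w₀ (fun s => if s = hcThird 0 2 then c w₀ 1 else c w₀ 2))) (c w₀ 0), hGΛ]
  -- the integrands agree: centre absorption + tangential clause
  have hint : (∫ p : ↥K₁ × ↥(unipotentU (starRingEnd ℂ) J), f ((Function.update c w₀ (fun s => if s = hcThird 0 2 then c w₀ 1 else c w₀ 2)), ((Circle.exp (((Function.update c w₀ (fun s => if s = hcThird 0 2 then c w₀ 1 else c w₀ 2)) w₀ 0 + (Function.update c w₀ (fun s => if s = hcThird 0 2 then c w₀ 1 else c w₀ 2)) w₀ 2) / 2) : Circle) : ℂ) • ((((((p.1 : ↥K₁) : ↥(unitaryGroupOfForm (starRingEnd ℂ) J)) * ((⟨hypBlockGL 0 0, hypBlockGL_mem_of_eq_over hJ 0 0⟩ : ↥(unitaryGroupOfForm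 (starRingEnd ℂ) J)) * (⟨hypBlockGL (c w₀ 0 / 2) 0, hypBlockGL_mem_of_eq_over hJ (c w₀ 0 / 2) 0⟩ : ↥(unitaryGroupOfForm (starRingEnd ℂ) J)) * ((p.2 : ↥(unipotentU (starRingEnd ℂ) J)) : ↥(unitaryGroupOfForm (starRingEnd ℂ) J)) * (⟨hypBlockGL (c w₀ 0 / 2) 0, hypBlockGL_mem_of_eq_over hJ (c w₀ 0 / 2) 0⟩ : ↥(unitaryGroupOfForm (starRingEnd ℂ) J))) * ((p.1 : ↥K₁) : ↥(unitaryGroupOfForm (starRingEnd ℂ) J))⁻¹ : ↥(unitaryGroupOfForm (starRingEnd ℂ) J))) : GL (Fin 2) ℂ) : Matrix (Fin 2) (Fin 2) ℂ)) ∂(κ.prod μN)) =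
      ∫ p : ↥K₁ × ↥(unipotentU (starRingEnd ℂ) J), f (Function.update c w₀ ![0, c w₀ 1, 0], ((((((p.1 : ↥K₁) : ↥(unitaryGroupOfForm (starRingEnd ℂ) J)) * ((⟨hypBlockGL 0 (c w₀ 2), hypBlockGL_mem_of_eq_over hJ 0 (c w₀ 2)⟩ : ↥(unitaryGroupOfForm (starRingEnd ℂ) J)) * (⟨hypBlockGL (c w₀ 0 / 2) 0, hypBlockGL_mem_of_eq_over hJ (c w₀ 0 / 2) 0⟩ : ↥(unitaryGroupOfForm (starRingEnd ℂ) J)) * ((p.2 : ↥(unipotentU (starRingEnd ℂ) J)) : ↥(unitaryGroupOfForm (starRingEnd ℂ) J)) * (⟨hypBlockGL (c w₀ 0 / 2) 0, hypBlockGL_mem_of_eq_over hJ (c w₀ 0 / 2) 0⟩ : ↥(unitaryGroupOfForm (starRingEnd ℂ) J))) * ((p.1 : ↥K₁) : ↥(unitaryGroupOfForm (starRingEnd ℂ) J))⁻¹ : ↥(unitaryGroupOfForm (starRingEnd ℂ) J))) : GL (Fin 2) ℂ) : Matrix (Fin 2) (Fin 2) ℂ)) ∂(κ.prod μN) := by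
    refine integral_congr_ae (Eventually.of_forall fun p => ?_)
    simp only []
    rw [hθ, smul_coe_conj_splitToken hJ, hftan (Function.update c w₀ (fun s => if s = hcThird 0 2 then c w₀ 1 else c w₀ 2)), hBupd]
  rw [hint]
  simp only [Complex.real_smul, Complex.ofReal_sub, Complex.ofReal_mul, Complex.ofReal_ofNat]
  ring

end Split2

end Literature.NumberTheory.Rogawski1990

end
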